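import Summits.AtomisticToContinuum.FouriersLaw.Theses.PuiseuxTransferLedger
import Summits.AtomisticToContinuum.FouriersLaw.Theorems.JunctionLocalityHarmonicCalibration
import Literature.MathematicalPhysics.KineticTheory.HarmonicChainNESS
import Literature.MathematicalPhysics.KineticTheory.HarmonicChainFlux
import HarnessLib

/-!
# `HarmonicTwoModeCalibration` (route PuiseuxTransferLedger), proved

Closes item `stmt-AtomisticToContinuum-12114` — the decl `HarmonicTwoModeCalibration` of
`Summits/AtomisticToContinuum/FouriersLaw/Theses/PuiseuxTransferLedger` (the regression test of the
route at the integrable corner): for the pinned HARMONIC chain `pinnedChain ω₂ 0 0 γ` (`ω₂, γ > 0`)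
the Gaussian steady states `harmonicNESS ω₂ γ` (Rieder–Lebowitz–Lieb 1967 / Nakazawa 1970, in the
tree: `HarmonicChainNESS.lean`) form a steady-state family along which, for every `T > 0`,

* the response coefficients exist and are `D_N = (N-1) c_N`, `c_N = fluxCoeff ω₂ γ N` (every bond
  carries `c_N (T_L - T_R)`; `JunctionLocality.totalCurrent_harmonicNESS` of
  `JunctionLocalityHarmonicCalibration.lean`, reused), positive for `N ≥ 2`;
* the kinetic-temperature response profile exists and is `t_N(i) = Y_ii/2` with `Y = oddY` the
  momentum block of the closed-form antisymmetric covariance `chainCov ω₂ γ N 1 (-1) = oddSol`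
  (`HarmonicChainFlux.lean`): the covariance is LINEAR in `(T_L, T_R)`
  (`chainCov_eq_add`), so `C(T+δ/2, T-δ/2) - C(T,T) = (δ/2)·C(1,-1)` and both difference
  quotients are constant in `δ` (`0 < |δ| < 2T`);
* the two-mode inequality with zero resistivity:
  `|t_N(i) - t_N(i+1)| ≤ C |D_N/(N-1)| (θ^i + θ^(N-2-i))` with `θ = rootR ω₂ γ ∈ (0,1)` and an
  `N`-independent `C`: by (H1) of `OddProfile`, `Y_ii - Y_{i+1,i+1} = ω₂γ/(1+γ²)(ζ_{2i+1} + ζ_{2i+2})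
  + γ²/(1+γ²)([i=0] + [i+1=N-1])`, `ζ_k ≤ γ/(1+γ²)(r^k + r^{2N-1-k})` (flat bulk, geometric boundary
  layers), while `c_N ≥ c_∞/2 = γ r/(4(1+γ²)) > 0` uniformly in `N`
  (`JunctionLocality.fluxLimit_div_two_le_fluxCoeff`, reused).

Main theorem: `harmonicTwoModeCalibration_proof`.
-/

noncomputable section

open MeasureTheory Filter Topology Matrix

namespace Summit.AtomisticToContinuum.FouriersLaw.Theorems

namespace HarmonicTwoModeCalibration

open Literature.MathematicalPhysics.KineticTheory.HeatConduction

variable {ω₂ γ : ℝ}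

/-! ### Linear response of the Gaussian covariance -/

/-- **Linearity of the stationary covariance in the bias**: at bath temperatures
`(T + δ/2, T - δ/2)` the covariance is `T·G + (δ/2)·C(1,-1)` with `G` the unit-temperature Gibbs
covariance and `C(1,-1)` the antisymmetric (odd) covariance. [folklore] -/
theorem chainCov_bias (hω : 0 < ω₂) (hγ : 0 < γ) (N : ℕ) (T δ : ℝ) :
    chainCov ω₂ γ N (T + δ / 2) (T - δ / 2) =
      T • gibbsCov ω₂ N + (δ / 2) • chainCov ω₂ γ N 1 (-1) := by
  rw [chainCov_eq_add hω hγ N (T + δ / 2) (T - δ / 2), chainCov_eq_add hω hγ N 1 (-1),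
    ← chainCov_one_zero_add hω hγ N]
  ext a b
  simp only [Matrix.add_apply, Matrix.smul_apply, smul_eq_mul]
  ring

/-- The second moment of `p_i` in the Gaussian NESS is the `(p_i, p_i)` entry of `chainCov`.
[folklore] -/
theorem integral_p_sq (hω : 0 < ω₂) (hγ : 0 < γ) (N : ℕ) {T_L T_R : ℝ} (hL : 0 < T_L)
    (hR : 0 < T_R) (i : Fin N) :
    ∫ x, (x.2 i) ^ 2 ∂(harmonicNESS ω₂ γ N T_L T_R) =
      chainCov ω₂ γ N T_L T_R (Sum.inr i) (Sum.inr i) := by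
  have h := integral_flat_mul_flat_harmonicNESS hω hγ N hL hR (Sum.inr i) (Sum.inr i)
  simp only [flat_inr] at h
  rw [← h]
  refine integral_congr_ae (Eventually.of_forall fun x => ?_)
  simp only [pow_two]

/-- **The kinetic-temperature profile is exactly affine in the bias**: for `0 < T ± δ/2`,
`⟨p_i²⟩_{T+δ/2,T-δ/2} - ⟨p_i²⟩_{T,T} = (δ/2)·Y_ii` with `Y = oddY N ω₂ γ (hSeq ω₂ γ N)` the
momentum block of the closed-form odd covariance. [folklore] -/
theorem profile_sub (hω : 0 < ω₂) (hγ : 0 < γ) (N : ℕ) {T δ : ℝ} (hT : 0 < T)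
    (h1 : 0 < T + δ / 2) (h2 : 0 < T - δ / 2) (i : Fin N) :
    (∫ x, (x.2 i) ^ 2 ∂(harmonicNESS ω₂ γ N (T + δ / 2) (T - δ / 2))) -
        ∫ x, (x.2 i) ^ 2 ∂(harmonicNESS ω₂ γ N T T) =
      δ / 2 * oddY N ω₂ γ (hSeq ω₂ γ N) i i := by
  rw [integral_p_sq hω hγ N h1 h2 i, integral_p_sq hω hγ N hT hT i, chainCov_bias hω hγ N T δ,
    chainCov_self hω hγ N T, chainCov_one_neg_one_eq hω hγ N]
  simp only [Matrix.add_apply, Matrix.smul_apply, smul_eq_mul, oddSol, fromBlocks_apply₂₂]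
  ring

/-- **The profile response exists** (difference quotient eventually constant):
`(⟨p_i²⟩_{T+δ/2,T-δ/2} - ⟨p_i²⟩_{T,T})/δ → Y_ii/2` as `δ → 0`, `δ ≠ 0`. [folklore] -/
theorem tendsto_profile (hω : 0 < ω₂) (hγ : 0 < γ) (N : ℕ) {T : ℝ} (hT : 0 < T) (i : Fin N) :
    Tendsto (fun δ : ℝ => ((∫ x, (x.2 i) ^ 2 ∂(harmonicNESS ω₂ γ N (T + δ / 2) (T - δ / 2))) -
        ∫ x, (x.2 i) ^ 2 ∂(harmonicNESS ω₂ γ N T T)) / δ) (𝓝[≠] 0)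
      (𝓝 (oddY N ω₂ γ (hSeq ω₂ γ N) i i / 2)) := by
  have hconst : ∀ᶠ δ in 𝓝[≠] (0 : ℝ),
      ((∫ x, (x.2 i) ^ 2 ∂(harmonicNESS ω₂ γ N (T + δ / 2) (T - δ / 2))) -
          ∫ x, (x.2 i) ^ 2 ∂(harmonicNESS ω₂ γ N T T)) / δ =
        oddY N ω₂ γ (hSeq ω₂ γ N) i i / 2 := by
    have hlt : ∀ᶠ δ in 𝓝 (0 : ℝ), δ < 2 * T := eventually_lt_nhds (by linarith)
    have hgt : ∀ᶠ δ in 𝓝 (0 : ℝ), -(2 * T) < δ := eventually_gt_nhds (by linarith)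
    have hne : ∀ᶠ δ in 𝓝[≠] (0 : ℝ), δ ≠ 0 := eventually_mem_nhdsWithin
    filter_upwards [mem_nhdsWithin_of_mem_nhds hlt, mem_nhdsWithin_of_mem_nhds hgt, hne]
      with δ hδlt hδgt hδ
    have hδ' : δ ≠ 0 := by simpa using hδ
    have ha : 0 < T + δ / 2 := by linarith
    have hb : 0 < T - δ / 2 := by linarith
    rw [profile_sub hω hγ N hT ha hb i]
    field_simp
  exact tendsto_const_nhds.congr' (hconst.mono fun δ hδ => hδ.symm)

/-! ### The response coefficient `D_N = (N-1) c_N` -/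

/-- **The response coefficient exists** (difference quotient eventually constant):
`totalCurrent(μ_{N,T+δ/2,T-δ/2})/δ → (N-1) c_N` as `δ → 0`, `δ ≠ 0`. [folklore] -/
theorem tendsto_current (hω : 0 < ω₂) (hγ : 0 < γ) (N : ℕ) {T : ℝ} (hT : 0 < T) :
    Tendsto (fun δ : ℝ => (pinnedChain ω₂ 0 0 γ).totalCurrent
        (harmonicNESS ω₂ γ N (T + δ / 2) (T - δ / 2)) / δ) (𝓝[≠] 0)
      (𝓝 (((N : ℝ) - 1) * fluxCoeff ω₂ γ N)) := by
  have hconst : ∀ᶠ δ in 𝓝[≠] (0 : ℝ), (pinnedChain ω₂ 0 0 γ).totalCurrent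
      (harmonicNESS ω₂ γ N (T + δ / 2) (T - δ / 2)) / δ = ((N : ℝ) - 1) * fluxCoeff ω₂ γ N := by
    have hlt : ∀ᶠ δ in 𝓝 (0 : ℝ), δ < 2 * T := eventually_lt_nhds (by linarith)
    have hgt : ∀ᶠ δ in 𝓝 (0 : ℝ), -(2 * T) < δ := eventually_gt_nhds (by linarith)
    have hne : ∀ᶠ δ in 𝓝[≠] (0 : ℝ), δ ≠ 0 := eventually_mem_nhdsWithin
    filter_upwards [mem_nhdsWithin_of_mem_nhds hlt, mem_nhdsWithin_of_mem_nhds hgt, hne]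
      with δ hδlt hδgt hδ
    have hδ' : δ ≠ 0 := by simpa using hδ
    have ha : 0 < T + δ / 2 := by linarith
    have hb : 0 < T - δ / 2 := by linarith
    rw [JunctionLocality.totalCurrent_harmonicNESS hω hγ N ha hb]
    field_simp
    ring
  exact tendsto_const_nhds.congr' (hconst.mono fun δ hδ => hδ.symm)

/-- `D_N = (N-1) c_N > 0` for `N ≥ 2`. [folklore] -/
theorem response_pos (hω : 0 < ω₂) (hγ : 0 < γ) {N : ℕ} (hN : 2 ≤ N) :
    0 < ((N : ℝ) - 1) * fluxCoeff ω₂ γ N := by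
  have hN2 : (2 : ℝ) ≤ (N : ℝ) := by exact_mod_cast hN
  exact mul_pos (by linarith) (JunctionLocality.fluxCoeff_pos hω hγ (by omega))

/-! ### The boundary layers of the profile -/

/-- `ζ_k ≤ γ/(1+γ²) (r^k + r^{2N-1-k})` for `k ≤ 2N-1` (`ζ_k = γ/(1+γ²) u_k/u_0`, `u_0 ≥ 1`).
[folklore] -/
theorem zetaSeq_le (hω : 0 < ω₂) (hγ : 0 < γ) (N : ℕ) {k : ℕ} (hk : k ≤ 2 * N - 1) :
    zetaSeq ω₂ γ N k ≤ γ / (1 + γ ^ 2) * (rootR ω₂ γ ^ k + rootR ω₂ γ ^ (2 * N - 1 - k)) := by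
  have hr := rootR_pos hω hγ
  have hu0 : 1 ≤ useq ω₂ γ N 0 := by
    unfold useq
    simp only [pow_zero, mul_one, le_add_iff_nonneg_right]
    positivity
  have huk : useq ω₂ γ N k = rootR ω₂ γ ^ k + rootR ω₂ γ ^ (2 * N - 1 - k) := by
    unfold useq
    obtain ⟨m, hm⟩ : ∃ m, 2 * N - 1 = k + m := ⟨2 * N - 1 - k, by omega⟩
    rw [hm, show k + m - k = m by omega, pow_add, inv_pow]
    field_simp
  have hnum : 0 ≤ rootR ω₂ γ ^ k + rootR ω₂ γ ^ (2 * N - 1 - k) := by positivity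
  unfold zetaSeq
  rw [huk]
  exact mul_le_mul_of_nonneg_left (div_le_self hnum hu0) (by positivity)

/-- `0 ≤ ζ_k`. [folklore] -/
theorem zetaSeq_nonneg (hω : 0 < ω₂) (hγ : 0 < γ) (N k : ℕ) : 0 ≤ zetaSeq ω₂ γ N k := by
  have h1 := useq_pos hω hγ N k
  have h2 := useq_pos hω hγ N 0
  unfold zetaSeq
  positivity

/-- **The profile step in closed form**: for the bond `(i, i+1)`,
`Y_ii/2 - Y_{i+1,i+1}/2 = ½[ω₂γ/(1+γ²)(ζ_{2i+1} + ζ_{2i+2}) + γ²/(1+γ²)([i=0]² + [i+1=N-1]²)]`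
(two applications of (H1) `h_m - h_{m+1} = γ ζ_{m+1}`). [folklore] -/
theorem profile_step_eq (hω : 0 < ω₂) (hγ : 0 < γ) {N : ℕ} (i j : Fin N)
    (hij : j.val = i.val + 1) :
    oddY N ω₂ γ (hSeq ω₂ γ N) i i / 2 - oddY N ω₂ γ (hSeq ω₂ γ N) j j / 2 =
      (ω₂ * γ / (1 + γ ^ 2) * (zetaSeq ω₂ γ N (2 * i.val + 1) + zetaSeq ω₂ γ N (2 * i.val + 2)) +
        γ ^ 2 / (1 + γ ^ 2) * (indL i * indL i + indR j * indR j)) / 2 := by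
  have P := oddProfile_explicit hω hγ N
  have e1 := P.h1 (2 * i.val)
  have e2 := P.h1 (2 * i.val + 1)
  rw [show 2 * i.val + 1 + 1 = 2 * i.val + 2 by ring] at e2
  have hjN := j.isLt
  have hRi : indR i = 0 := indR_of_ne (by omega)
  have hLj : indL j = 0 := indL_of_ne (by omega)
  rw [oddY_apply, oddY_apply, hRi, hLj, show i.val + i.val = 2 * i.val by ring,
    show j.val + j.val = 2 * i.val + 2 by omega]
  linear_combination (ω₂ / (1 + γ ^ 2) / 2) * (e1 + e2)

/-- **Geometric boundary layers**: for the bond `(i, i+1)`,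
`|Y_ii/2 - Y_{i+1,i+1}/2| ≤ K (r^i + r^{N-2-i})` with
`K = ω₂γ/(1+γ²) · γ/(1+γ²) + γ²/(2(1+γ²))` and `r = rootR ω₂ γ`. [folklore] -/
theorem profile_step_le (hω : 0 < ω₂) (hγ : 0 < γ) {N : ℕ} (i j : Fin N)
    (hij : j.val = i.val + 1) :
    |oddY N ω₂ γ (hSeq ω₂ γ N) i i / 2 - oddY N ω₂ γ (hSeq ω₂ γ N) j j / 2| ≤
      (ω₂ * γ / (1 + γ ^ 2) * (γ / (1 + γ ^ 2)) + γ ^ 2 / (1 + γ ^ 2) / 2) *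
        (rootR ω₂ γ ^ i.val + rootR ω₂ γ ^ (N - 2 - i.val)) := by
  have hr := rootR_pos hω hγ
  have hr1 := rootR_lt_one hω hγ
  have hjN := j.isLt
  rw [profile_step_eq hω hγ i j hij]
  set r := rootR ω₂ γ with hr'
  set n := i.val with hn
  -- the pieces are nonnegative
  have hz1 := zetaSeq_nonneg hω hγ N (2 * n + 1)
  have hz2 := zetaSeq_nonneg hω hγ N (2 * n + 2)
  have hL0 : 0 ≤ indL i * indL i := mul_self_nonneg _
  have hR0 : 0 ≤ indR j * indR j := mul_self_nonneg _
  have hc1 : 0 ≤ ω₂ * γ / (1 + γ ^ 2) := by positivity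
  have hc2 : 0 ≤ γ ^ 2 / (1 + γ ^ 2) := by positivity
  have hc3 : 0 ≤ γ / (1 + γ ^ 2) := by positivity
  -- geometric bounds
  have hζ1 := zetaSeq_le hω hγ N (k := 2 * n + 1) (by omega)
  have hζ2 := zetaSeq_le hω hγ N (k := 2 * n + 2) (by omega)
  rw [← hr'] at hζ1 hζ2
  have hp1 : r ^ (2 * n + 1) ≤ r ^ n := pow_le_pow_of_le_one hr.le hr1.le (by omega)
  have hp2 : r ^ (2 * N - 1 - (2 * n + 1)) ≤ r ^ (N - 2 - n) :=
    pow_le_pow_of_le_one hr.le hr1.le (by omega)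
  have hp3 : r ^ (2 * n + 2) ≤ r ^ n := pow_le_pow_of_le_one hr.le hr1.le (by omega)
  have hp4 : r ^ (2 * N - 1 - (2 * n + 2)) ≤ r ^ (N - 2 - n) :=
    pow_le_pow_of_le_one hr.le hr1.le (by omega)
  have hL : indL i * indL i ≤ r ^ n := by
    by_cases h0 : i.val = 0
    · rw [indL_of_eq h0, hn, h0, pow_zero, mul_one]
    · rw [indL_of_ne h0, mul_zero]; positivity
  have hR : indR j * indR j ≤ r ^ (N - 2 - n) := by
    by_cases hN : j.val = N - 1
    · rw [indR_of_eq hN, show N - 2 - n = 0 by omega, pow_zero, mul_one]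
    · rw [indR_of_ne hN, mul_zero]; positivity
  have hsum : zetaSeq ω₂ γ N (2 * n + 1) + zetaSeq ω₂ γ N (2 * n + 2) ≤
      γ / (1 + γ ^ 2) * (2 * (r ^ n + r ^ (N - 2 - n))) := by
    calc zetaSeq ω₂ γ N (2 * n + 1) + zetaSeq ω₂ γ N (2 * n + 2)
        ≤ γ / (1 + γ ^ 2) * (r ^ (2 * n + 1) + r ^ (2 * N - 1 - (2 * n + 1))) +
            γ / (1 + γ ^ 2) * (r ^ (2 * n + 2) + r ^ (2 * N - 1 - (2 * n + 2))) := add_le_add hζ1 hζ2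
      _ = γ / (1 + γ ^ 2) * ((r ^ (2 * n + 1) + r ^ (2 * N - 1 - (2 * n + 1))) +
            (r ^ (2 * n + 2) + r ^ (2 * N - 1 - (2 * n + 2)))) := by ring
      _ ≤ γ / (1 + γ ^ 2) * (2 * (r ^ n + r ^ (N - 2 - n))) :=
          mul_le_mul_of_nonneg_left (by linarith) hc3
  have h0 : 0 ≤ (ω₂ * γ / (1 + γ ^ 2) *
      (zetaSeq ω₂ γ N (2 * n + 1) + zetaSeq ω₂ γ N (2 * n + 2)) +
        γ ^ 2 / (1 + γ ^ 2) * (indL i * indL i + indR j * indR j)) / 2 := by positivity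
  rw [abs_of_nonneg h0]
  calc (ω₂ * γ / (1 + γ ^ 2) * (zetaSeq ω₂ γ N (2 * n + 1) + zetaSeq ω₂ γ N (2 * n + 2)) +
          γ ^ 2 / (1 + γ ^ 2) * (indL i * indL i + indR j * indR j)) / 2
      = ω₂ * γ / (1 + γ ^ 2) / 2 * (zetaSeq ω₂ γ N (2 * n + 1) + zetaSeq ω₂ γ N (2 * n + 2)) +
          γ ^ 2 / (1 + γ ^ 2) / 2 * (indL i * indL i + indR j * indR j) := by ring
    _ ≤ ω₂ * γ / (1 + γ ^ 2) / 2 * (γ / (1 + γ ^ 2) * (2 * (r ^ n + r ^ (N - 2 - n)))) +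
          γ ^ 2 / (1 + γ ^ 2) / 2 * (r ^ n + r ^ (N - 2 - n)) :=
        add_le_add (mul_le_mul_of_nonneg_left hsum (by positivity))
          (mul_le_mul_of_nonneg_left (add_le_add hL hR) (by positivity))
    _ = (ω₂ * γ / (1 + γ ^ 2) * (γ / (1 + γ ^ 2)) + γ ^ 2 / (1 + γ ^ 2) / 2) *
          (r ^ n + r ^ (N - 2 - n)) := by ring

end HarmonicTwoModeCalibration

open Literature.MathematicalPhysics.KineticTheory.HeatConduction HarmonicTwoModeCalibration

/-- **`HarmonicTwoModeCalibration` (item stmt-AtomisticToContinuum-12114) holds.** For the pinned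
harmonic chain `pinnedChain ω₂ 0 0 γ` (`ω₂, γ > 0`) the Gaussian steady states `harmonicNESS ω₂ γ`
(Rieder–Lebowitz–Lieb 1967 / Nakazawa 1970; weak steady states by `isSteadyState_harmonicNESS`)
form a family along which, for every `T > 0`: the response coefficients are `D_N = (N-1) c_N`
(`c_N = fluxCoeff ω₂ γ N`), the profile responses are `t_N(i) = Y_ii/2` (`Y` the momentum block of
the closed-form odd covariance `oddSol`), `D_N > 0` for `N ≥ 2`, and the two-mode inequality holds
with zero resistivity, ratio `θ = rootR ω₂ γ` and
`C = (ω₂γ²/(1+γ²)² + γ²/(2(1+γ²))) / (c_∞/2)`, `c_∞ = fluxLimit ω₂ γ = γ r/(2(1+γ²))`: flat bulk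
with geometric boundary layers.
[cite: BonettoLebowitzReyBellet2000, §6.2] -/
theorem harmonicTwoModeCalibration_proof :
    Summit.AtomisticToContinuum.FouriersLaw.Theses.PuiseuxTransferLedger.HarmonicTwoModeCalibration := by
  intro ω₂ γ hω hγ
  refine ⟨harmonicNESS ω₂ γ, fun N T_L T_R hL hR => isSteadyState_harmonicNESS hω hγ N hL hR,
    fun T hT => ?_⟩
  have hr := rootR_pos hω hγ
  have hr1 := rootR_lt_one hω hγ
  -- the constants
  set K : ℝ := ω₂ * γ / (1 + γ ^ 2) * (γ / (1 + γ ^ 2)) + γ ^ 2 / (1 + γ ^ 2) / 2 with hK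
  set c₀ : ℝ := fluxLimit ω₂ γ / 2 with hc₀
  have hK0 : 0 ≤ K := by positivity
  have hc₀0 : 0 < c₀ := half_pos (fluxLimit_pos hω hγ)
  refine ⟨fun N => ((N : ℝ) - 1) * fluxCoeff ω₂ γ N, fun N i => oddY N ω₂ γ (hSeq ω₂ γ N) i i / 2,
    rootR ω₂ γ, K / c₀, hr.le, hr1, fun N => tendsto_current hω hγ N hT,
    fun N i => tendsto_profile hω hγ N hT i, fun N hN => response_pos hω hγ hN, ?_⟩
  intro N i j hij
  have hjN := j.isLt
  have hN : 2 ≤ N := by omega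
  have hN1 : (N : ℝ) - 1 ≠ 0 := by
    have : (2 : ℝ) ≤ (N : ℝ) := by exact_mod_cast hN
    linarith
  have hflux : c₀ ≤ fluxCoeff ω₂ γ N :=
    JunctionLocality.fluxLimit_div_two_le_fluxCoeff hω hγ (by omega : 1 < N)
  have hflux0 : 0 < fluxCoeff ω₂ γ N := lt_of_lt_of_le hc₀0 hflux
  have hDabs : |((N : ℝ) - 1) * fluxCoeff ω₂ γ N / ((N : ℝ) - 1)| = fluxCoeff ω₂ γ N := by
    rw [mul_div_cancel_left₀ _ hN1, abs_of_pos hflux0]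
  have hS : 0 ≤ rootR ω₂ γ ^ i.val + rootR ω₂ γ ^ (N - 2 - i.val) := by positivity
  have hKc : 0 ≤ K / c₀ := div_nonneg hK0 hc₀0.le
  show |oddY N ω₂ γ (hSeq ω₂ γ N) i i / 2 - oddY N ω₂ γ (hSeq ω₂ γ N) j j / 2| ≤
    K / c₀ * |((N : ℝ) - 1) * fluxCoeff ω₂ γ N / ((N : ℝ) - 1)| *
      (rootR ω₂ γ ^ i.val + rootR ω₂ γ ^ (N - 2 - i.val))
  rw [hDabs]
  calc |oddY N ω₂ γ (hSeq ω₂ γ N) i i / 2 - oddY N ω₂ γ (hSeq ω₂ γ N) j j / 2|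
      ≤ K * (rootR ω₂ γ ^ i.val + rootR ω₂ γ ^ (N - 2 - i.val)) := profile_step_le hω hγ i j hij
    _ = K / c₀ * c₀ * (rootR ω₂ γ ^ i.val + rootR ω₂ γ ^ (N - 2 - i.val)) := by
        rw [div_mul_cancel₀ K hc₀0.ne']
    _ ≤ K / c₀ * fluxCoeff ω₂ γ N * (rootR ω₂ γ ^ i.val + rootR ω₂ γ ^ (N - 2 - i.val)) :=
        mul_le_mul_of_nonneg_right (mul_le_mul_of_nonneg_left hflux hKc) hS

end Summit.AtomisticToContinuum.FouriersLaw.Theorems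

end
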